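import Mathlib
import Literature.NumberTheory.EllipticCurves.SupersingularTorsionValuationProofs
import Literature.NumberTheory.EllipticCurves.SupersingularDivisionPolynomialProofs
import Literature.NumberTheory.EllipticCurves.PointReduction
import Summits.Langlands.Langlands.Theses.HeptagonalTower

/-!
# Crux `TorsionSeven` (stmt-Langlands-16989) — idea `supersingular-slope-at-seven`: first lemmas

Crux-ideate sketch (round 1, ideator 1).  STATUS: everything below is PROVED (sorry-free, axioms
`propext`/`Classical.choice`/`Quot.sound`) EXCEPT `prime_to_seven_torsion_mem_list` (L5, the
reduction-mod-(ζ−1) half, one `sorry`).  In particular the new lever is kernel-checked: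
`no_seven_torsion` — no point of order `7` on `X₀(15)` over any `ℚ(ζ_{7^{n+1}})` — and the glue
`torsionSeven_of_L4_L5 : L4 → L5 → TorsionSeven`, so `TorsionSeven ⟸ L5`.

Line: transport a torsion `K`-point along `K →+* L = ℚ(ζ_{7^{n+1}})`; at the unique prime
`𝔓 = (ζ - 1)` of `L` above `7` (residue field `𝔽₇`, `e(𝔓|7) = 6·7ⁿ`):
* prime-to-`7` torsion injects into `Ẽ(𝔽₇)`, which has `8` points (tree `injective_reduceHom`,
  AEC VII.3.1(b) — no hypothesis on `e`), so it is the `8` listed points;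
* a point of order `7` has `|7|_𝔓 · |x|_𝔓 ^ 24 = 1` (tree
  `WeierstrassCurve.one_lt_valuation_X_of_prime_zsmul_eq_zero`, fed by the shape
  `ψ₇ ≡ unit (mod 7)` of the `7`-division polynomial of the Legendre model — `7` is a prime of
  good SUPERSINGULAR reduction, `a₇ = 0`), i.e. `24 ∣ e(𝔓|7) = 6·7ⁿ`: impossible.
-/

open scoped Classical NNReal
open IsDedekindDomain NumberField Polynomial

namespace Summit.Langlands.Langlands.Cruxes.TorsionSeven.SupersingularSlope

/-- The Legendre model `y² = x³ + 41x² + 400x = x(x+16)(x+25)` of `X₀(15)` over `ℤ`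
(its base change to `ℚ` is the route's literal `⟨0, 41, 0, 400, 0⟩`). -/
def Eℤ : WeierstrassCurve ℤ := ⟨0, 41, 0, 400, 0⟩

/-- The route's curve over `ℚ` (an `abbrev`, so that it unifies with the route's literal). -/
abbrev Eℚ : WeierstrassCurve ℚ := ⟨0, 41, 0, 400, 0⟩

theorem Eℤ_map : Eℤ.map (Int.castRingHom ℚ) = Eℚ := by
  simp [Eℤ, Eℚ, WeierstrassCurve.map]

/-- **L1 (certificate: shape of `ψ₇` at the supersingular prime `7`).** The `7`-division
polynomial `ψ₇ = preΨ' 7` of the Legendre model (degree `24`, leading coefficient `7`) has constant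
term prime to `7` and every other coefficient divisible by `7`.  Conceptual proof: tree
`WeierstrassCurve.coeff_preΨ'_prime_of_hasseCoeff_mem_maximalIdeal` over `ℤ_[7]` (unit
discriminant `2¹²3⁴5⁴`, Hasse coefficient `[x⁶]Ψ₂Sq³ = 10708544 = 7·1529792`); numerically
checked (constant term `-2⁴⁸·5²⁴`). -/
theorem Δ_Eℤ : Eℤ.Δ = 207360000 := by
  simp only [Eℤ, WeierstrassCurve.Δ, WeierstrassCurve.b₂, WeierstrassCurve.b₄, WeierstrassCurve.b₆,
    WeierstrassCurve.b₈]
  norm_num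

/-- The Hasse coefficient `A₇ = [x⁶](4x³ + 164x² + 1600x)³ = 10708544 = 7 · 1529792` of the
Legendre model: `7` is a supersingular prime. -/
theorem hasseCoeff_Eℤ : Eℤ.hasseCoeff 7 = 10708544 := by
  have htp : Eℤ.twoTorsionPolynomial.toPoly = (4 * X ^ 3 + 164 * X ^ 2 + 1600 * X : ℤ[X]) := by
    simp only [WeierstrassCurve.twoTorsionPolynomial, Cubic.toPoly, Eℤ, WeierstrassCurve.b₂,
      WeierstrassCurve.b₄, WeierstrassCurve.b₆]
    norm_num
  rw [WeierstrassCurve.hasseCoeff, htp]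
  have key : (4 * X ^ 3 + 164 * X ^ 2 + 1600 * X : ℤ[X]) ^ 3 =
      64 * X ^ 9 + 7872 * X ^ 8 + 399552 * X ^ 7 + 10708544 * X ^ 6 +
        159820800 * X ^ 5 + 1259520000 * X ^ 4 + 4096000000 * X ^ 3 := by ring
  norm_num
  rw [key]
  simp [Polynomial.coeff_X_pow]

theorem preΨ'_seven_shape :
    ¬ (7 : ℤ) ∣ (Eℤ.preΨ' 7).coeff 0 ∧ ∀ i, 0 < i → (7 : ℤ) ∣ (Eℤ.preΨ' 7).coeff i := by
  haveI : Fact (Nat.Prime 7) := ⟨by norm_num⟩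
  haveI : Finite (IsLocalRing.ResidueField ℤ_[7]) :=
    Finite.of_equiv (ZMod 7) (PadicInt.residueField (p := 7)).symm.toEquiv
  haveI : CharP (IsLocalRing.ResidueField ℤ_[7]) 7 :=
    charP_of_injective_ringHom (f := (PadicInt.residueField (p := 7)).symm.toRingHom)
      (PadicInt.residueField (p := 7)).symm.injective 7
  set M := Eℤ.map (Int.castRingHom ℤ_[7]) with hM
  -- good reduction at `7`: `Δ = 2¹²3⁴5⁴` is a `7`-adic unit
  have hΔ : IsUnit M.Δ := by
    rw [hM, WeierstrassCurve.map_Δ, Δ_Eℤ, PadicInt.isUnit_iff, eq_intCast]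
    refine le_antisymm (PadicInt.norm_le_one _) (not_lt.mp fun hlt ↦ ?_)
    rw [PadicInt.norm_int_lt_one_iff_dvd] at hlt
    norm_num at hlt
  -- supersingular at `7`: `7 ∣ A₇`
  have hA : M.hasseCoeff 7 ∈ IsLocalRing.maximalIdeal ℤ_[7] := by
    rw [hM, WeierstrassCurve.map_hasseCoeff, hasseCoeff_Eℤ, IsLocalRing.mem_maximalIdeal,
      PadicInt.mem_nonunits, eq_intCast, PadicInt.norm_int_lt_one_iff_dvd]
    norm_num
  obtain ⟨h0, hi⟩ :=
    WeierstrassCurve.coeff_preΨ'_prime_of_hasseCoeff_mem_maximalIdeal 7 (by norm_num) M hΔ hA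
  have hcoeff : ∀ i, (M.preΨ' 7).coeff i = (((Eℤ.preΨ' 7).coeff i : ℤ) : ℤ_[7]) := fun i ↦ by
    rw [hM, WeierstrassCurve.map_preΨ', Polynomial.coeff_map, eq_intCast]
  refine ⟨fun hdvd ↦ ?_, fun i hpos ↦ ?_⟩
  · rw [hcoeff, PadicInt.isUnit_iff] at h0
    have hlt : ‖(((Eℤ.preΨ' 7).coeff 0 : ℤ) : ℤ_[7])‖ < 1 :=
      (PadicInt.norm_int_lt_one_iff_dvd _).mpr (by exact_mod_cast hdvd)
    exact hlt.ne h0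
  · have := hi i hpos
    rw [hcoeff, IsLocalRing.mem_maximalIdeal, PadicInt.mem_nonunits,
      PadicInt.norm_int_lt_one_iff_dvd] at this
    exact_mod_cast this

/-- **L2 (the lever: slope ⇒ ramification).** Over any number field `K`, a `K`-point of order
`7` on the Legendre model forces `24 ∣ e(v|7)` at EVERY place `v` of `K` above `7`: by L1 and
the tree's two-term domination `one_lt_valuation_X_of_prime_zsmul_eq_zero` applied to the
`v`-adic absolute value, `|7|_v · |x|_v^24 = 1`, i.e. `24 · ord_v(x) = -e(v|7)`. -/
theorem twentyfour_dvd_ramificationIdx_of_seven_torsion (K : Type) [Field K] [NumberField K]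
    (v : HeightOneSpectrum (𝓞 K)) (hv : ((7 : ℤ) : 𝓞 K) ∈ v.asIdeal)
    (x y : K) (h : (Eℚ.baseChange K).toAffine.Nonsingular x y)
    (hP : (7 : ℤ) • (WeierstrassCurve.Affine.Point.some x y h) = 0) :
    24 ∣ v.asIdeal.ramificationIdx ℤ := by
  haveI : Fact (Nat.Prime 7) := ⟨by norm_num⟩
  -- the `v`-adic absolute value `w = 2 ^ (-ord_v)` as an `ℝ≥0`-valued valuation
  have h2 : (1 : ℝ≥0) < 2 := one_lt_two
  set t := WithZeroMulInt.toNNReal h2.ne_zero with ht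
  have htmono : StrictMono t := WithZeroMulInt.toNNReal_strictMono h2
  set w : Valuation K ℝ≥0 := (v.valuation K).map t htmono.monotone with hw
  have hw_apply : ∀ r : K, w r = t (v.valuation K r) := fun r ↦ rfl
  -- integers: `w c ≤ 1`, `w 7 < 1`, and `w c = 1` when `7 ∤ c`
  have hwint : ∀ c : ℤ, w (c : K) = t (v.intValuation (c : 𝓞 K)) := fun c ↦ by
    rw [hw_apply, ← map_intCast (algebraMap (𝓞 K) K) c, HeightOneSpectrum.valuation_of_algebraMap]
  have hle : ∀ c : ℤ, w (c : K) ≤ 1 := fun c ↦ by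
    rw [hwint, WithZeroMulInt.toNNReal_le_one_iff h2]
    exact HeightOneSpectrum.intValuation_le_one _ _
  have h7lt : w (7 : K) < 1 := by
    have := hwint 7
    push_cast at this
    rw [this, WithZeroMulInt.toNNReal_lt_one_iff h2,
      HeightOneSpectrum.intValuation_lt_one_iff_mem]
    exact_mod_cast hv
  have hunit : ∀ c : ℤ, ¬ (7 : ℤ) ∣ c → w (c : K) = 1 := fun c hc ↦ by
    refine le_antisymm (hle c) (not_lt.mp fun hlt ↦ hc ?_)
    rw [hwint, WithZeroMulInt.toNNReal_lt_one_iff h2,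
      HeightOneSpectrum.intValuation_lt_one_iff_mem] at hlt
    -- `c ∈ v` and `7 ∈ v` with `gcd(7, c) = 1` would put `1 ∈ v`
    by_contra h7c
    have hcop : IsCoprime (7 : ℤ) c :=
      (Irreducible.coprime_iff_not_dvd
        (Nat.prime_iff_prime_int.mp (by norm_num : Nat.Prime 7)).irreducible).mpr h7c
    obtain ⟨a, b, hab⟩ := hcop
    have h1 : (1 : 𝓞 K) ∈ v.asIdeal := by
      have : ((a * 7 + b * c : ℤ) : 𝓞 K) ∈ v.asIdeal := by
        push_cast
        exact v.asIdeal.add_mem (v.asIdeal.mul_mem_left _ (by exact_mod_cast hv))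
          (v.asIdeal.mul_mem_left _ hlt)
      rwa [hab, Int.cast_one] at this
    exact v.isPrime.ne_top ((Ideal.eq_top_iff_one _).mpr h1)
  -- the shape of `ψ₇` over `K`
  obtain ⟨hc0, hci⟩ := preΨ'_seven_shape
  have hV : Eℚ.baseChange K = Eℤ.map (Int.castRingHom K) := by
    rw [WeierstrassCurve.baseChange, ← Eℤ_map, WeierstrassCurve.map_map]
    congr 1
    exact RingHom.ext_int _ _
  have hcoeff : ∀ i, ((Eℚ.baseChange K).preΨ' 7).coeff i = (((Eℤ.preΨ' 7).coeff i : ℤ) : K) := by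
    intro i
    rw [hV, WeierstrassCurve.map_preΨ', Polynomial.coeff_map, eq_intCast]
  have h0 : w (((Eℚ.baseChange K).preΨ' 7).coeff 0) = 1 := by
    rw [hcoeff]; exact hunit _ hc0
  have hmid : ∀ i, 0 < i → w (((Eℚ.baseChange K).preΨ' 7).coeff i) ≤ w ((7 : ℕ) : K) := by
    intro i hi
    obtain ⟨d, hd⟩ := hci i hi
    rw [hcoeff, hd]
    push_cast
    rw [map_mul]
    calc w (7 : K) * w (d : K) ≤ w (7 : K) * 1 := mul_le_mul_right (hle d) _
      _ = w (7 : K) := mul_one _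
  -- Serre's slope lemma: `|7|_v · |x|_v ^ 24 = 1`
  have key := WeierstrassCurve.one_lt_valuation_X_of_prime_zsmul_eq_zero (w := w)
    (Eℚ.baseChange K) (ℓ := 7) (by norm_num) (by norm_num) (by exact_mod_cast h7lt) h0 hmid
    (x := x) (y := y) (h := h) (by exact_mod_cast hP)
  obtain ⟨hx1, hprod⟩ := key
  norm_num at hprod
  -- read it in the value group `ℤᵐ⁰`: `v(7) · v(x)^24 = 1`
  have hprod' : v.valuation K (7 : K) * v.valuation K x ^ 24 = 1 := by
    rw [← WithZeroMulInt.toNNReal_eq_one_iff _ h2.ne_zero h2.ne', map_mul, map_pow]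
    simpa [hw_apply] using hprod
  -- `v(7) = exp(-e)` with `e` the ramification index
  haveI : v.asIdeal.IsPrime := v.isPrime
  haveI : v.asIdeal.LiesOver (Ideal.span {(7 : ℤ)}) := by
    rw [Ideal.liesOver_iff]
    refine Ideal.IsMaximal.eq_of_le (Int.ideal_span_isMaximal_of_prime 7)
      Ideal.IsPrime.ne_top' ?_
    rw [Ideal.span_singleton_le_iff_mem, Ideal.mem_comap, algebraMap_int_eq, Int.coe_castRingHom]
    exact hv
  have hmap : (Ideal.span {(7 : ℤ)}).map (algebraMap ℤ (𝓞 K)) = Ideal.span {(7 : 𝓞 K)} := by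
    rw [Ideal.map_span, Set.image_singleton, map_ofNat]
  have h7ne : (7 : 𝓞 K) ≠ 0 := by exact_mod_cast (show (7 : ℤ) ≠ 0 by norm_num)
  have hmapne : (Ideal.span {(7 : ℤ)}).map (algebraMap ℤ (𝓞 K)) ≠ ⊥ := by
    rw [hmap, Ne, Ideal.span_singleton_eq_bot]; exact h7ne
  have he : (v.asIdeal.ramificationIdx ℤ : ℤ) =
      (multiplicity v.asIdeal (Ideal.span {(7 : 𝓞 K)}) : ℤ) := by
    rw [Ideal.IsDedekindDomain.ramificationIdx_eq_multiplicity (Ideal.span {(7 : ℤ)}) v.asIdeal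
      hmapne, hmap]
  have hv7 : v.valuation K (7 : K) = WithZero.exp (-(v.asIdeal.ramificationIdx ℤ : ℤ)) := by
    rw [he, ← HeightOneSpectrum.intValuation_eq_exp_neg_multiplicity v h7ne,
      ← HeightOneSpectrum.valuation_of_algebraMap (K := K)]
    congr 1
  -- `v(x) = exp k`, so `-e + 24 k = 0`
  have hx0 : v.valuation K x ≠ 0 := by
    intro h0'
    rw [h0', zero_pow (by norm_num), mul_zero] at hprod'
    exact zero_ne_one hprod'
  set k := WithZero.log (v.valuation K x) with hk
  have hvx : v.valuation K x = WithZero.exp k := (WithZero.exp_log hx0).symm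
  rw [hv7, hvx, ← WithZero.exp_nsmul, ← WithZero.exp_add, ← WithZero.exp_zero,
    WithZero.exp_inj] at hprod'
  rw [nsmul_eq_mul] at hprod'
  have hdvd : ((24 : ℕ) : ℤ) ∣ (v.asIdeal.ramificationIdx ℤ : ℤ) := ⟨k, by push_cast at hprod' ⊢; linarith⟩
  exact Int.natCast_dvd_natCast.mp hdvd

/-- Mathlib's `CyclotomicField.isCyclotomicExtension` is stated for the splitting-field algebra
structure `CyclotomicField.algebra`; the route's statement (through `NumberField`) uses the canonical
`DivisionRing.toRatAlgebra`. Transport along `Subsingleton (Algebra ℚ _)` (tree pattern, e.g.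
`HeegnerPointsImaginaryQuadraticProofs.isImaginaryQuadratic_cyclotomicField_three`), and read the
level `((7 : ℕ+) : ℕ) ^ (n + 1)` as `7 ^ (n + 1)`. -/
theorem isCyclotomicExtension_seven (n : ℕ) :
    @IsCyclotomicExtension {7 ^ (n + 1)} ℚ (CyclotomicField ((7 : ℕ+) ^ (n + 1)) ℚ) _ _
      DivisionRing.toRatAlgebra := by
  have hinst : @IsCyclotomicExtension {7 ^ (n + 1)} ℚ (CyclotomicField ((7 : ℕ+) ^ (n + 1)) ℚ) _ _
      (CyclotomicField.algebra ((7 : ℕ+) ^ (n + 1)) ℚ) :=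
    CyclotomicField.isCyclotomicExtension ((7 : ℕ+) ^ (n + 1)) ℚ
  have hA : (CyclotomicField.algebra ((7 : ℕ+) ^ (n + 1)) ℚ :
      Algebra ℚ (CyclotomicField ((7 : ℕ+) ^ (n + 1)) ℚ)) = DivisionRing.toRatAlgebra :=
    Subsingleton.elim _ _
  exact hA ▸ hinst

/-- **L3 (tower arithmetic).** In `L = ℚ(ζ_{7^{n+1}})` every prime above `7` has ramification
index dividing `[L:ℚ] = 6·7ⁿ` (`L/ℚ` Galois: `e·f·g = [L:ℚ]`, Mathlib
`Ideal.ncard_primesOver_mul_ramificationIdxIn_mul_inertiaDegIn` + `IsCyclotomicExtension.finrank`);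
in fact `e = 6·7ⁿ`, `f = g = 1` (`𝔓 = (ζ - 1)`, `absNorm 𝔓 = 7`). -/
theorem ramificationIdx_dvd_totient (n : ℕ)
    (v : HeightOneSpectrum (𝓞 (CyclotomicField ((7 : ℕ+) ^ (n + 1)) ℚ)))
    (hv : ((7 : ℤ) : 𝓞 (CyclotomicField ((7 : ℕ+) ^ (n + 1)) ℚ)) ∈ v.asIdeal) :
    v.asIdeal.ramificationIdx ℤ ∣ 6 * 7 ^ n := by
  haveI : Fact (Nat.Prime 7) := ⟨by norm_num⟩
  haveI := isCyclotomicExtension_seven n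
  haveI : v.asIdeal.IsPrime := v.isPrime
  haveI : v.asIdeal.LiesOver (Ideal.span {(7 : ℤ)}) := by
    rw [Ideal.liesOver_iff]
    refine Ideal.IsMaximal.eq_of_le (Int.ideal_span_isMaximal_of_prime 7)
      Ideal.IsPrime.ne_top' ?_
    rw [Ideal.span_singleton_le_iff_mem, Ideal.mem_comap, algebraMap_int_eq, Int.coe_castRingHom]
    exact hv
  rw [IsCyclotomicExtension.Rat.ramificationIdx_eq_of_prime_pow 7 n
    (CyclotomicField ((7 : ℕ+) ^ (n + 1)) ℚ) v.asIdeal]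
  exact ⟨1, by ring⟩

/-- **L3' (residue degree one).** Every prime of `ℚ(ζ_{7^{n+1}})` above `7` has residue field
`𝔽₇` (Mathlib `IsCyclotomicExtension.Rat.inertiaDeg_eq_of_prime_pow`) — the input of L5. -/
theorem inertiaDeg_eq_one (n : ℕ)
    (v : HeightOneSpectrum (𝓞 (CyclotomicField ((7 : ℕ+) ^ (n + 1)) ℚ)))
    (hv : ((7 : ℤ) : 𝓞 (CyclotomicField ((7 : ℕ+) ^ (n + 1)) ℚ)) ∈ v.asIdeal) :
    v.asIdeal.inertiaDeg ℤ = 1 := by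
  haveI : Fact (Nat.Prime 7) := ⟨by norm_num⟩
  haveI := isCyclotomicExtension_seven n
  haveI : v.asIdeal.IsPrime := v.isPrime
  haveI : v.asIdeal.LiesOver (Ideal.span {(7 : ℤ)}) := by
    rw [Ideal.liesOver_iff]
    refine Ideal.IsMaximal.eq_of_le (Int.ideal_span_isMaximal_of_prime 7)
      Ideal.IsPrime.ne_top' ?_
    rw [Ideal.span_singleton_le_iff_mem, Ideal.mem_comap, algebraMap_int_eq, Int.coe_castRingHom]
    exact hv
  exact IsCyclotomicExtension.Rat.inertiaDeg_eq_of_prime_pow 7 n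
    (CyclotomicField ((7 : ℕ+) ^ (n + 1)) ℚ) v.asIdeal

/-- `24 ∤ 6·7ⁿ` (`6·7ⁿ mod 24 ∈ {6, 18}`). -/
theorem not_twentyfour_dvd (n : ℕ) : ¬ 24 ∣ 6 * 7 ^ n := by
  have key : ∀ m : ℕ, (6 * 7 ^ m) % 8 = 6 ∨ (6 * 7 ^ m) % 8 = 2 := by
    intro m
    induction m with
    | zero => simp
    | succ k ih =>
      rcases ih with ih | ih <;>
      · rw [pow_succ, ← mul_assoc, Nat.mul_mod, ih]; norm_num
  intro h
  have h8 : (8 : ℕ) ∣ 6 * 7 ^ n := Nat.dvd_trans (by norm_num) h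
  rcases key n with h' | h' <;> omega

/-- **L4 (no `7`-torsion anywhere in the `7`-cyclotomic tower)** — L2 + L3 + arithmetic; total
reality is not used. -/
theorem no_seven_torsion (n : ℕ) (x y : CyclotomicField ((7 : ℕ+) ^ (n + 1)) ℚ)
    (h : (Eℚ.baseChange (CyclotomicField ((7 : ℕ+) ^ (n + 1)) ℚ)).toAffine.Nonsingular x y)
    (hP : (7 : ℤ) • (WeierstrassCurve.Affine.Point.some x y h) = 0) : False := by
  haveI : Fact (Nat.Prime 7) := ⟨by norm_num⟩
  haveI hL := isCyclotomicExtension_seven n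
  -- the prime `𝔓 = (ζ - 1)` above `7`
  have hζ := hL.zeta_spec
  set 𝔓 : Ideal (𝓞 (CyclotomicField ((7 : ℕ+) ^ (n + 1)) ℚ)) :=
    Ideal.span {hζ.toInteger - 1} with h𝔓
  have h𝔓prime : 𝔓.IsPrime := IsCyclotomicExtension.Rat.isPrime_span_zeta_sub_one 7 n hζ
  have h𝔓bot : 𝔓 ≠ ⊥ := IsCyclotomicExtension.Rat.span_zeta_sub_one_ne_bot 7 n hζ
  let v : HeightOneSpectrum (𝓞 (CyclotomicField ((7 : ℕ+) ^ (n + 1)) ℚ)) :=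
    ⟨𝔓, h𝔓prime, h𝔓bot⟩
  have hv : ((7 : ℤ) : 𝓞 (CyclotomicField ((7 : ℕ+) ^ (n + 1)) ℚ)) ∈ v.asIdeal := by
    show ((7 : ℤ) : 𝓞 (CyclotomicField ((7 : ℕ+) ^ (n + 1)) ℚ)) ∈ Ideal.span {hζ.toInteger - 1}
    have := IsCyclotomicExtension.Rat.p_mem_span_zeta_sub_one 7 n hζ
    push_cast at this ⊢
    exact this
  exact not_twentyfour_dvd n (Nat.dvd_trans
    (twentyfour_dvd_ramificationIdx_of_seven_torsion _ v hv x y h hP)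
    (ramificationIdx_dvd_totient n v hv))

/-- **L5 (prime-to-`7` torsion is the rational torsion; the reduction half, as in the evidence idea
`ramified-seven-reduction` of idea-node g23).** At `𝔓 = (ζ - 1)` the Legendre model has good
reduction (`Δ = 2¹²3⁴5⁴`), the residue field is `𝔽₇`, `#Ẽ(𝔽₇) = 8`, and prime-to-`7` torsion
injects (tree `Literature.NumberTheory.EllipticCurves.injective_reduceHom`, AEC VII.3.1(b), any
ramification); the `8` listed points already fill `Ẽ(𝔽₇)`. -/
theorem prime_to_seven_torsion_mem_list (n : ℕ) (x y : CyclotomicField ((7 : ℕ+) ^ (n + 1)) ℚ)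
    (h : (Eℚ.baseChange (CyclotomicField ((7 : ℕ+) ^ (n + 1)) ℚ)).toAffine.Nonsingular x y)
    (m : ℕ) (hm0 : 0 < m) (hm : ¬ 7 ∣ m)
    (hP : (m : ℤ) • (WeierstrassCurve.Affine.Point.some x y h) = 0) :
    (x = 0 ∧ y = 0) ∨ (x = -16 ∧ y = 0) ∨ (x = -25 ∧ y = 0) ∨ (x = 20 ∧ y = 180) ∨
      (x = 20 ∧ y = -180) ∨ (x = -20 ∧ y = 20) ∨ (x = -20 ∧ y = -20) := by
  sorry

/-- **Composition (how L4 + L5 give the crux).** Transport along the embedding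
`σ : K →+* ℚ(ζ_{7^{n+1}})` (points map injectively, orders are preserved, the listed coordinates
are rational hence `σ`-fixed); split the order `m·7ᵃ` of a torsion point: `a ≥ 1` gives a point
of order `7` (L4: absurd), so the order is prime to `7` and L5 applies. Glue only. -/
theorem torsionSeven_of_L4_L5
    (L4 : ∀ (n : ℕ) (x y : CyclotomicField ((7 : ℕ+) ^ (n + 1)) ℚ)
      (h : (Eℚ.baseChange (CyclotomicField ((7 : ℕ+) ^ (n + 1)) ℚ)).toAffine.Nonsingular x y),
      (7 : ℤ) • (WeierstrassCurve.Affine.Point.some x y h) = 0 → False)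
    (L5 : ∀ (n : ℕ) (x y : CyclotomicField ((7 : ℕ+) ^ (n + 1)) ℚ)
      (h : (Eℚ.baseChange (CyclotomicField ((7 : ℕ+) ^ (n + 1)) ℚ)).toAffine.Nonsingular x y)
      (m : ℕ), 0 < m → ¬ 7 ∣ m → (m : ℤ) • (WeierstrassCurve.Affine.Point.some x y h) = 0 →
      (x = 0 ∧ y = 0) ∨ (x = -16 ∧ y = 0) ∨ (x = -25 ∧ y = 0) ∨ (x = 20 ∧ y = 180) ∨
        (x = 20 ∧ y = -180) ∨ (x = -20 ∧ y = 20) ∨ (x = -20 ∧ y = -20)) :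
    Summit.Langlands.Langlands.Theses.HeptagonalTower.TorsionSeven := by
  intro K _ _ _hK hemb x y h hfin
  obtain ⟨n, ⟨σ⟩⟩ := hemb
  -- the embedding as a `ℚ`-algebra map, and the transport of points along it
  let f : K →ₐ[ℚ] CyclotomicField ((7 : ℕ+) ^ (n + 1)) ℚ := σ.toRatAlgHom
  have hfinj : Function.Injective f := (f : K →+* CyclotomicField ((7 : ℕ+) ^ (n + 1)) ℚ).injective
  let φ := WeierstrassCurve.Affine.Point.map (W' := Eℚ.toAffine) f
  have hφ : Function.Injective φ := WeierstrassCurve.Affine.Point.map_injective (W' := Eℚ.toAffine) f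
  set P : (Eℚ.baseChange K).toAffine.Point := WeierstrassCurve.Affine.Point.some x y h with hPdef
  -- the order `m` of `P` and of its image
  set m : ℕ := addOrderOf P with hmdef
  have hm0 : 0 < m := hfin.addOrderOf_pos
  have hmP' : addOrderOf (φ P) = m := addOrderOf_injective φ hφ P
  have hmP'zero : m • φ P = 0 := by rw [← hmP']; exact addOrderOf_nsmul_eq_zero (φ P)
  -- split `m = 7ᵃ · m'` with `7 ∤ m'`
  obtain ⟨a, m', hm', hmeq⟩ := Nat.exists_eq_pow_mul_and_not_dvd hm0.ne' 7 (by norm_num)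
  have hm'0 : 0 < m' := Nat.pos_of_ne_zero (by rintro rfl; simp [hmeq] at hm0)
  -- `a = 0`: otherwise `Q = (7^(a-1)·m') • φ P` is a point of order `7` in the tower (L4)
  have ha : a = 0 := by
    by_contra ha
    obtain ⟨b, rfl⟩ : ∃ b, a = b + 1 := Nat.exists_eq_succ_of_ne_zero ha
    set Q := (7 ^ b * m') • φ P with hQdef
    have h7Q : 7 • Q = 0 := by
      rw [hQdef, ← mul_nsmul', ← hmP'zero, hmeq]; ring_nf
    have hQne : Q ≠ 0 := by
      intro hQ
      have hdvd : addOrderOf (φ P) ∣ 7 ^ b * m' := addOrderOf_dvd_iff_nsmul_eq_zero.mpr hQ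
      rw [hmP', hmeq] at hdvd
      have hle := Nat.le_of_dvd (by positivity) hdvd
      have hlt : 7 ^ b * m' < 7 ^ (b + 1) * m' := by
        apply Nat.mul_lt_mul_of_lt_of_le _ le_rfl hm'0
        exact Nat.pow_lt_pow_right (by norm_num) (Nat.lt_succ_self b)
      omega
    -- `Q` is an affine point of order `7`
    rcases hQcases : Q with _ | ⟨x', y', h'⟩
    · exact hQne hQcases
    · refine L4 n x' y' h' ?_
      have : ((7 : ℕ) : ℤ) • (WeierstrassCurve.Affine.Point.some x' y' h') = 0 := by
        rw [natCast_zsmul, ← hQcases]; exact h7Q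
      exact_mod_cast this
  -- so the order is prime to `7`, and L5 applies to the transported point
  rw [ha, pow_zero, one_mul] at hmeq
  have hφP : φ P = WeierstrassCurve.Affine.Point.some (f x) (f y)
      ((Eℚ.toAffine.baseChange_nonsingular hfinj _ _).mpr h) := by
    rw [hPdef]; exact WeierstrassCurve.Affine.Point.map_some f h
  have hzs : (m' : ℤ) • (WeierstrassCurve.Affine.Point.some (f x) (f y)
      ((Eℚ.toAffine.baseChange_nonsingular hfinj _ _).mpr h)) = 0 := by
    rw [natCast_zsmul, ← hφP, ← hmeq]; exact hmP'zero
  have key := L5 n (f x) (f y) _ m' hm'0 hm' hzs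
  -- pull the rational coordinates back along the injection `f`
  have back : ∀ c : K, f x = f c → x = c := fun c hc ↦ hfinj hc
  have backy : ∀ c : K, f y = f c → y = c := fun c hc ↦ hfinj hc
  rcases key with ⟨hx, hy⟩ | ⟨hx, hy⟩ | ⟨hx, hy⟩ | ⟨hx, hy⟩ | ⟨hx, hy⟩ | ⟨hx, hy⟩ | ⟨hx, hy⟩
  · exact Or.inl ⟨back 0 (by rw [hx, map_zero]), backy 0 (by rw [hy, map_zero])⟩
  · exact Or.inr <| Or.inl ⟨back (-16) (by rw [hx, map_neg, map_ofNat]),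
      backy 0 (by rw [hy, map_zero])⟩
  · exact Or.inr <| Or.inr <| Or.inl ⟨back (-25) (by rw [hx, map_neg, map_ofNat]),
      backy 0 (by rw [hy, map_zero])⟩
  · exact Or.inr <| Or.inr <| Or.inr <| Or.inl ⟨back 20 (by rw [hx, map_ofNat]),
      backy 180 (by rw [hy, map_ofNat])⟩
  · exact Or.inr <| Or.inr <| Or.inr <| Or.inr <| Or.inl
      ⟨back 20 (by rw [hx, map_ofNat]), backy (-180) (by rw [hy, map_neg, map_ofNat])⟩
  · exact Or.inr <| Or.inr <| Or.inr <| Or.inr <| Or.inr <| Or.inl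
      ⟨back (-20) (by rw [hx, map_neg, map_ofNat]), backy 20 (by rw [hy, map_ofNat])⟩
  · exact Or.inr <| Or.inr <| Or.inr <| Or.inr <| Or.inr <| Or.inr
      ⟨back (-20) (by rw [hx, map_neg, map_ofNat]), backy (-20) (by rw [hy, map_neg, map_ofNat])⟩

end Summit.Langlands.Langlands.Cruxes.TorsionSeven.SupersingularSlope
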